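import Summits.BirchSwinnertonDyer.BirchSwinnertonDyer.Theses.ErratumRoadFive
import HarnessLib

/-!
# Route `ErratumRoadFive` (rung K2 of BirchSwinnertonDyer): the glue item `PublishedInputsFiveOfParts`
# (stmt-BirchSwinnertonDyer-19385) of the by-name split of the support item `PublishedInputsFive`

Cell `bsd-stepL` (run/shared/lean/pub/bsd-stepL/), seat `bsd-stepL-imc-p1` (prover), session g2, on the
planner's request (planner g24, INBOX l.81; term verbatim from the planner's farm-checked sketch
`plan/staffable-v1/AliasSketch-ErratumRoadFive-k7.lean`). HONEST FRAMING: pure bookkeeping — the seven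
children of the split (`SkinnerRankZeroPPart`, `WuthrichShaDividesAnalyticSha`, `RankEqAnalyticRankLeOne`,
`EntireLFunctionRat`, `NewformOfEllipticCurve`, `MazurManinConstantOddPrimes` — each a PUBLISHED named
fact stated by name — and the rest child `ClassicalAndTwistInputsFive`) re-assemble into the parent
conjunction `PublishedInputsFive` in its original order; nothing is asserted about any of the facts;
BSD is not proved by any of this; closes rung K2 of BirchSwinnertonDyer for NO pair. THEOREMS ONLY.
-/

set_option autoImplicit false
set_option linter.dupNamespace false

namespace Summit.BirchSwinnertonDyer.BirchSwinnertonDyer.Theorems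

open Summit.BirchSwinnertonDyer.BirchSwinnertonDyer.Theses

/-- **Glue of the split of `PublishedInputsFive` (item 19385).** The six by-name children and the
rest child `ClassicalAndTwistInputsFive` imply the parent conjunction `PublishedInputsFive`: the
anonymous constructor re-assembling the fifteen conjuncts in their original order (children 4–8 and
11 are the by-name facts; the rest child carries conjuncts 1–3, 9–10, 12–15). Bookkeeping only.
[folklore] -/
theorem publishedInputsFiveOfParts_holds : ErratumRoadFive.PublishedInputsFiveOfParts :=
  fun h4 h5 h6 h7 h8 h11 hR => by
    obtain ⟨h1, h2, h3, h9, h10, h12, h13, h14, h15⟩ := hR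
    exact ⟨h1, h2, h3, h4, h5, h6, h7, h8, h9, h10, h11, h12, h13, h14, h15⟩

end Summit.BirchSwinnertonDyer.BirchSwinnertonDyer.Theorems
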